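import Mathlib
import HarnessLib
import Summits.Ventures.LatticeQCDFlow.Scoring.IMHPoissonTransfer

/-!
# Liu's eigenvalue theorem for the exact flow-MCMC (IMH) chain, finite form:
# `charpoly K = (X − 1) · ∏_{x ≠ ℓ} (X − (1 − a x))` — the relaxation spectrum is read off the weights

HONEST FRAMING: exact (Metropolis-corrected) sampling algorithms for lattice gauge theory;
figures of merit are autocorrelation/cost numbers at stated couplings and volumes; no
continuum-physics claim.

Venture `LatticeQCDFlow` (cell pub-lqcd), topic `Scoring`; flow seat (`pub-lqcd-flow`, gen-24),
landing the last un-landed part of its own kernel-checked offer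
`HOME/canary-flow/imhlaw/lean/ImhPoissonTree-v2.lean` (gen-15d, `section spectrum`; the rest of that
file is row 8's `Scoring/IMHPoissonTransfer.lean`) and completing it from the relaxation part `G`
to the transition matrix `K` itself.  NEW WORK of the cell in the sense of the placement rule
(elementary finite linear algebra on the tree's objects `Exactness.imhKernel`, `Scoring.imhMatrix`,
`Scoring.liuG`; no definition is added, nothing is cited as a tree fact).  The statement is the
finite-state-space form of Liu's eigen-analysis of the Metropolized independence sampler
[J. S. Liu, Statistics and Computing 6 (1996) 113, Thm 2.1; Monte Carlo Strategies in Scientific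
Computing §13.4.1], which `IMHPoissonTransfer.lean` names as CONTEXT: here its content —
"the eigenvalues of the independence sampler are `1` and `1 − a(x)`, `a(x) = Σ_z q_z min(1, w_z/w_x)`
the move-acceptance probability out of `x`, for every state but the lightest" — gets a
kernel-checked proof on a finite state space, ties in the weight included.  This is statement (T1)
of the flow seat's `HOME/canary-flow/imhlaw/IMH-LAW-flow.md` §1 ("τ_exp and the whole relaxation
spectrum of the exact flow-MCMC chain are functionals of the stored importance weights alone — no
chain needs to be run"), the companion of (T2) Poisson transfer and (T3) Green–Kubo already in the
tree (`IMHPoissonTransfer.lean`, `IMHGreenKubo.lean`, `IMHLevelDecomposition.lean`).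

## Setting

A finite state space `X`, target `p > 0`, model (proposal) law `q > 0`; `K = imhMatrix p q` the
exact flow-MCMC transition matrix, `G = K − 𝟙 qᵀ` Liu's split (`liuG`), whose diagonal is
`G x x = 1 − a x` with `a x = Σ_z min (q z) (p z q x / p x)` the move-acceptance probability out of
`x` (`one_sub_liuG_diag_eq_sum_min`).  A LIGHTEST state `ℓ` is one with `w ℓ ≤ w x` for all `x`,
`w = p/q`, written cross-multiplied `p ℓ · q x ≤ p x · q ℓ` (`exists_lightest`).

## Content

* `charpoly_eq_prod_of_key` — bookkeeping: a matrix vanishing below the diagonal of SOME linear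
  order of the index type (given by an injective key into a linearly ordered type) has the
  characteristic polynomial of its diagonal (`Matrix.charpoly_of_upperTriangular` under
  `LinearOrder.lift'`).
* `liuG_eq_zero_of_lexKey` — Liu's triangularity `G x y = 0` towards heavier `y`
  (`liuG_eq_zero_of_heavier`) along the weight order with TIES BROKEN by any enumeration.
* **`liuG_charpoly`** — `charpoly G = ∏_x (X − G x x)`: the spectrum of the relaxation part is
  `{1 − a x : x ∈ X}` (with multiplicity), for every `p, q > 0`.
* `liuG_diag_eq_zero_of_lightest` — the lightest state moves at every step: `a ℓ = 1`
  (`G ℓ ℓ = 0`) when `Σ q = 1`.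
* **`imhMatrix_charpoly`** — LIU'S THEOREM FOR THE CHAIN ITSELF:
  `charpoly K = (X − 1) · ∏_{x ≠ ℓ} (X − G x x)`, i.e. the eigenvalues of the exact flow-MCMC
  transition matrix are `1` and `1 − a x` for `x ≠ ℓ`, with multiplicity
  (`imhMatrix_charpoly_roots`); in particular the second eigenvalue is `1 − a(heaviest state)`
  (`one_sub_liuG_diag_antitone` in `IMHPoissonTransfer.lean` orders them).  Proof: conjugate `K` by
  `P = 1 + E`, `E = (𝟙 − e_ℓ) e_ℓᵀ` (`E² = 0`, `P⁻¹ = 1 − E`): `P⁻¹ K P` has row/column `ℓ` equal to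
  `(1, q)` / `(1, 0)` and the block `G` restricted to `x ≠ ℓ` elsewhere (row-stochasticity of `K` and
  `K ℓ y = q y`: the lightest state accepts every proposal), so it is triangular for the order
  "`ℓ` first, then decreasing weight"; `charpoly` is a similarity invariant (`Matrix.charpoly_mul_comm`).
* `imhMatrix_charpoly_mul_X` — the two statements differ by the factor `X` vs `X − 1`:
  `charpoly K · X = (X − 1) · charpoly G` (`Σ q = 1`).
* `imhMatrix_charpoly_eval_one`, `imhMatrix_charpoly_eval_diag` — `1` and every `1 − a x`, `x ≠ ℓ`,
  are roots.

NOT CLAIMED: general (continuous) state spaces — Liu's theorem there, and the geometric-ergodicity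
rate `1 − 1/w⋆` of Mengersen–Tweedie, stay the Literature statement
`Probability/MarkovChains/MengersenTweedie.lean`; eigenVECTORS are not exhibited (the flow seat's
`imhlaw.py` uses only the diagonal of the triangular factor, which is what is certified); nothing
about `τ_int` beyond what `IMHGreenKubo.lean` / `IMHLevelDecomposition(Tau).lean` already state;
no number of any chain file is used or implied.
-/

namespace Summit.Ventures.LatticeQCDFlow.Scoring

open Finset Literature.Probability.MarkovChains Summit.Ventures.LatticeQCDFlow.Exactness

variable {X : Type*} [Fintype X] [DecidableEq X]

/-! ### Bookkeeping: triangular along some linear order ⇒ `charpoly` = product over the diagonal -/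

/-- A square matrix that vanishes below the diagonal of SOME linear order of the index type — the
order being given by an injective `key` into a linearly ordered type, `M i j = 0` whenever
`key j < key i` — has characteristic polynomial `∏_i (X − M i i)`. -/
theorem charpoly_eq_prod_of_key {κ : Type*} [LinearOrder κ] (key : X → κ)
    (hkey : Function.Injective key) (M : Matrix X X ℝ)
    (hM : ∀ i j, key j < key i → M i j = 0) :
    M.charpoly = ∏ i, (Polynomial.X - Polynomial.C (M i i)) := by
  letI : LinearOrder X := LinearOrder.lift' key hkey
  have hBT : M.BlockTriangular id := fun i j h => hM i j h
  convert Matrix.charpoly_of_upperTriangular M hBT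

/-! ### The relaxation part `G`: Liu's triangularity with ties broken, and `charpoly G` -/

/-- Liu's triangularity along the weight order with ties broken by an arbitrary enumeration
`e : X → ℕ`: if `(−w y, e y) < (−w x, e x)` lexicographically (`y` strictly heavier than `x`, or as
heavy and enumerated earlier) then `G x y = 0`. -/
theorem liuG_eq_zero_of_lexKey {p q : X → ℝ} (hp : ∀ x, 0 < p x) (hq : ∀ x, 0 < q x) (e : X → ℕ)
    {x y : X} (h : toLex (-(p y / q y), e y) < toLex (-(p x / q x), e x)) : liuG p q x y = 0 := by
  rcases Prod.Lex.toLex_lt_toLex.mp h with h1 | ⟨h1, h2⟩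
  · -- strictly heavier destination
    have hw : p x / q x < p y / q y := by linarith
    have hne : y ≠ x := by
      rintro rfl
      exact lt_irrefl _ hw
    have hw' : p x * q y ≤ p y * q x := by
      rw [div_lt_div_iff₀ (hq x) (hq y)] at hw
      exact hw.le
    exact liuG_eq_zero_of_heavier hp hne hw'
  · -- equal weight, tie broken by the enumeration
    have hne : y ≠ x := by
      rintro rfl
      exact lt_irrefl _ h2
    have hw : p y / q y = p x / q x := by linarith
    have hw' : p x * q y ≤ p y * q x := by
      rw [div_eq_div_iff (hq y).ne' (hq x).ne'] at hw
      linarith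
    exact liuG_eq_zero_of_heavier hp hne hw'

/-- **Liu's eigenvalue theorem for the relaxation part.**  For every target `p > 0` and model law
`q > 0` on a finite state space, `charpoly G = ∏_x (X − G x x)` with `G = K − 𝟙 qᵀ` (`liuG`) and
`G x x = 1 − a x`, `a x = Σ_z min (q z) (p z q x / p x)` the move-acceptance probability out of `x`
(`one_sub_liuG_diag_eq_sum_min`): the spectrum of `G`, with algebraic multiplicity, is
`{1 − a x : x ∈ X}` — a functional of the importance weights alone.  (Refine the weight preorder to
a linear order by an enumeration of `X`; `G` is triangular for it by `liuG_eq_zero_of_lexKey`.) -/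
theorem liuG_charpoly {p q : X → ℝ} (hp : ∀ x, 0 < p x) (hq : ∀ x, 0 < q x) :
    (Matrix.of (liuG p q)).charpoly = ∏ x, (Polynomial.X - Polynomial.C (liuG p q x x)) := by
  let e : X ≃ Fin (Fintype.card X) := Fintype.equivFin X
  let key : X → ℝ ×ₗ ℕ := fun x => toLex (-(p x / q x), (e x : ℕ))
  have hkey : Function.Injective key := by
    intro x y hxy
    have h2 : (ofLex (key x)).2 = (ofLex (key y)).2 := by rw [hxy]
    have h3 : (e x : ℕ) = (e y : ℕ) := by simpa [key] using h2
    exact e.injective (Fin.ext h3)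
  exact charpoly_eq_prod_of_key key hkey (Matrix.of (liuG p q))
    (fun x y h => liuG_eq_zero_of_lexKey hp hq (fun z => (e z : ℕ)) h)

/-- … so every `G x x = 1 − a x` is a root of `charpoly G`. -/
theorem liuG_charpoly_eval_diag {p q : X → ℝ} (hp : ∀ x, 0 < p x) (hq : ∀ x, 0 < q x) (x : X) :
    (Matrix.of (liuG p q)).charpoly.eval (liuG p q x x) = 0 := by
  rw [liuG_charpoly hp hq, Polynomial.eval_prod]
  exact Finset.prod_eq_zero (Finset.mem_univ x) (by simp)

/-- `G 𝟙 = 0`: the rows of Liu's `G` sum to zero when the model law is normalised (`Σ q = 1`). -/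
theorem liuG_row_sum {q : X → ℝ} (hq1 : ∑ x, q x = 1) (p : X → ℝ) (x : X) :
    ∑ y, liuG p q x y = 0 := by
  unfold liuG rankOneSplit imhKernel
  rw [Finset.sum_sub_distrib, mhKernel_sum_eq_one, hq1, sub_self]

/-- `K` and `G` act identically modulo constants: `K h − G h = (qᵀ h) · 𝟙` for every `h`. -/
theorem imhKernel_mulVec_sub_liuG_mulVec (p q h : X → ℝ) (x : X) :
    ∑ y, imhKernel p q x y * h y - ∑ y, liuG p q x y * h y = ∑ y, q y * h y := by
  unfold liuG rankOneSplit
  rw [← Finset.sum_sub_distrib]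
  exact Finset.sum_congr rfl fun y _ => by ring

/-! ### The lightest state -/

omit [DecidableEq X] in
/-- A lightest state exists: some `ℓ` with `w ℓ ≤ w x` for all `x` (`w = p/q`, cross-multiplied). -/
theorem exists_lightest [Nonempty X] (p q : X → ℝ) (hq : ∀ x, 0 < q x) :
    ∃ ℓ, ∀ x, p ℓ * q x ≤ p x * q ℓ := by
  obtain ⟨ℓ, -, hℓ⟩ := Finset.exists_min_image univ (fun x => p x / q x) univ_nonempty
  refine ⟨ℓ, fun x => ?_⟩
  have h : p ℓ / q ℓ ≤ p x / q x := hℓ x (mem_univ x)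
  rwa [div_le_div_iff₀ (hq ℓ) (hq x)] at h

/-- The lightest state accepts every proposal, so it moves at every step: `a ℓ = 1`, i.e.
`G ℓ ℓ = 0` (model law normalised, `Σ q = 1`). -/
theorem liuG_diag_eq_zero_of_lightest {p q : X → ℝ} (hp : ∀ x, 0 < p x) (hq1 : ∑ x, q x = 1)
    {ℓ : X} (hℓ : ∀ x, p ℓ * q x ≤ p x * q ℓ) : liuG p q ℓ ℓ = 0 := by
  have hrow := liuG_row_sum hq1 p ℓ
  rw [← Finset.add_sum_erase _ _ (mem_univ ℓ)] at hrow
  have hoff : ∑ y ∈ univ.erase ℓ, liuG p q ℓ y = 0 :=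
    Finset.sum_eq_zero fun y hy => liuG_eq_zero_of_heavier hp (Finset.ne_of_mem_erase hy) (hℓ y)
  linarith

/-! ### Liu's eigenvalue theorem for the transition matrix `K` -/

/-- **Liu's eigenvalue theorem for the exact flow-MCMC (IMH) transition matrix, finite form.**
For target `p > 0`, model law `q > 0` and a lightest state `ℓ` (`w ℓ ≤ w x` for all `x`):
`charpoly K = (X − 1) · ∏_{x ≠ ℓ} (X − G x x)` with `G x x = 1 − a x` — the eigenvalues of the
independence sampler, with algebraic multiplicity, are `1` and the rejection probabilities
`1 − a x` of every state but the lightest; all of them are read off the importance weights with no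
chain run.  Proof: with `E = (𝟙 − e_ℓ) e_ℓᵀ` (`E² = 0`) the conjugate `(1 − E) K (1 + E)` has
entries `1` at `(ℓ, ℓ)`, `0` at `(i, ℓ)` for `i ≠ ℓ` (row sums of `K` are `1`), and `G i j` at
`i, j ≠ ℓ` (because `K ℓ j = q j`: the lightest state accepts every proposal); it is triangular for
the order "`ℓ` first, then decreasing weight, ties by enumeration" (`liuG_eq_zero_of_lexKey`), and
`charpoly` is invariant under the conjugation (`Matrix.charpoly_mul_comm`). -/
theorem imhMatrix_charpoly {p q : X → ℝ} (hp : ∀ x, 0 < p x) (hq : ∀ x, 0 < q x) {ℓ : X}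
    (hℓ : ∀ x, p ℓ * q x ≤ p x * q ℓ) :
    (imhMatrix p q).charpoly = (Polynomial.X - Polynomial.C 1) *
      ∏ x ∈ univ.erase ℓ, (Polynomial.X - Polynomial.C (liuG p q x x)) := by
  set K : Matrix X X ℝ := imhMatrix p q with hK
  -- the indicator of `ℓ` and the nilpotent `E = (𝟙 − e_ℓ) e_ℓᵀ`
  let v : X → ℝ := fun x => if x = ℓ then 1 else 0
  have hvℓ : v ℓ = 1 := if_pos rfl
  have hv0 : ∀ k, k ≠ ℓ → v k = 0 := fun k hk => if_neg hk
  let E : Matrix X X ℝ := Matrix.of fun i j => (1 - v i) * v j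
  -- row sums of `K` are one; the lightest state accepts every proposal
  have hrow : ∀ i, ∑ k, K i k = 1 := by
    intro i
    simp only [hK, imhMatrix_apply]
    unfold imhKernel
    exact mhKernel_sum_eq_one _ _ i
  have hKℓ : ∀ j, j ≠ ℓ → K ℓ j = q j := by
    intro j hj
    simp only [hK, imhMatrix_apply]
    exact imhKernel_eq_of_heavier hp hj (hℓ j)
  -- sums against the indicator
  have hsumv : ∀ f : X → ℝ, ∑ k, f k * v k = f ℓ := by
    intro f
    have h : ∀ k, f k * v k = if k = ℓ then f k else 0 := by
      intro k
      by_cases hk : k = ℓ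
      · rw [hk, hvℓ, mul_one, if_pos rfl]
      · rw [hv0 k hk, mul_zero, if_neg hk]
    simp_rw [h]
    rw [Finset.sum_ite_eq' univ ℓ f, if_pos (mem_univ ℓ)]
  have hsumv' : ∀ f : X → ℝ, ∑ k, v k * f k = f ℓ := by
    intro f
    rw [← hsumv f]
    exact Finset.sum_congr rfl fun k _ => mul_comm _ _
  -- `E² = 0`
  have hEE : E * E = 0 := by
    ext i j
    simp only [Matrix.mul_apply, Matrix.of_apply, Matrix.zero_apply, E]
    refine Finset.sum_eq_zero fun k _ => ?_
    by_cases hk : k = ℓ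
    · rw [hk, hvℓ]; ring
    · rw [hv0 k hk]; ring
  -- entries of `K E` and `E M`
  have hKE : ∀ i j, (K * E) i j = v j * (1 - K i ℓ) := by
    intro i j
    simp only [Matrix.mul_apply, Matrix.of_apply, E]
    calc ∑ k, K i k * ((1 - v k) * v j)
        = ∑ k, (v j * K i k - v j * (K i k * v k)) :=
          Finset.sum_congr rfl fun k _ => by ring
      _ = v j * ∑ k, K i k - v j * ∑ k, K i k * v k := by
          rw [Finset.sum_sub_distrib, Finset.mul_sum, Finset.mul_sum]
      _ = v j * (1 - K i ℓ) := by rw [hrow i, hsumv (K i)]; ring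
  have hEM : ∀ (M : Matrix X X ℝ) (i j : X), (E * M) i j = (1 - v i) * M ℓ j := by
    intro M i j
    simp only [Matrix.mul_apply, Matrix.of_apply, E]
    calc ∑ k, (1 - v i) * v k * M k j = (1 - v i) * ∑ k, v k * M k j := by
          rw [Finset.mul_sum]
          exact Finset.sum_congr rfl fun k _ => by ring
      _ = (1 - v i) * M ℓ j := by rw [hsumv' (fun k => M k j)]
  -- the conjugate `N = (1 − E) K (1 + E)` and its entries
  set N : Matrix X X ℝ := (1 - E) * (K * (1 + E)) with hN
  have hNapply : ∀ i j,
      N i j = K i j + v j * (1 - K i ℓ) - (1 - v i) * (K ℓ j + v j * (1 - K ℓ ℓ)) := by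
    intro i j
    have hK1E : K * (1 + E) = K + K * E := by rw [Matrix.mul_add, Matrix.mul_one]
    rw [hN, hK1E, Matrix.sub_mul, Matrix.one_mul, Matrix.sub_apply, hEM, Matrix.add_apply,
      Matrix.add_apply, hKE, hKE]
  have hNℓℓ : N ℓ ℓ = 1 := by
    rw [hNapply, hvℓ]
    ring
  have hNiℓ : ∀ i, i ≠ ℓ → N i ℓ = 0 := by
    intro i hi
    rw [hNapply, hvℓ, hv0 i hi]
    ring
  have hNij : ∀ i j, i ≠ ℓ → j ≠ ℓ → N i j = liuG p q i j := by
    intro i j hi hj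
    rw [hNapply, hv0 j hj, hv0 i hi, hKℓ j hj]
    simp only [hK, imhMatrix_apply]
    unfold liuG rankOneSplit
    ring
  -- `N` is triangular for the order "ℓ first, then decreasing weight, ties by enumeration"
  let e : X ≃ Fin (Fintype.card X) := Fintype.equivFin X
  let key : X → ℕ ×ₗ ℝ ×ₗ ℕ := fun x =>
    toLex (if x = ℓ then 0 else 1, toLex (-(p x / q x), (e x : ℕ)))
  have hkey : Function.Injective key := by
    intro x y hxy
    have h2 : (ofLex (ofLex (key x)).2).2 = (ofLex (ofLex (key y)).2).2 := by rw [hxy]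
    have h3 : (e x : ℕ) = (e y : ℕ) := by simpa [key] using h2
    exact e.injective (Fin.ext h3)
  have htri : ∀ i j, key j < key i → N i j = 0 := by
    intro i j h
    rcases Prod.Lex.toLex_lt_toLex.mp h with h1 | ⟨h1, h2⟩
    · -- the first components differ: `j = ℓ` and `i ≠ ℓ`
      have hj : j = ℓ := by
        by_contra hj
        by_cases hi : i = ℓ <;> simp [hj, hi] at h1
      have hi : i ≠ ℓ := by
        intro hi
        simp [hj, hi] at h1
      rw [hj]
      exact hNiℓ i hi
    · by_cases hj : j = ℓ
      · -- then `i = ℓ` as well, and the inner strict inequality is absurd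
        have hi : i = ℓ := by
          by_contra hi
          simp [hj, hi] at h1
        rw [hj, hi] at h2
        exact absurd h2 (lt_irrefl _)
      · have hi : i ≠ ℓ := by
          intro hi
          simp [hj, hi] at h1
        rw [hNij i j hi hj]
        exact liuG_eq_zero_of_lexKey hp hq (fun z => (e z : ℕ)) h2
  have hcharN : N.charpoly = ∏ i, (Polynomial.X - Polynomial.C (N i i)) :=
    charpoly_eq_prod_of_key key hkey N htri
  -- `charpoly` is a similarity invariant: `charpoly K = charpoly N`
  have h1E : (1 + E) * (1 - E) = 1 := by
    rw [Matrix.add_mul, Matrix.mul_sub, Matrix.mul_sub, Matrix.one_mul, Matrix.one_mul,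
      Matrix.mul_one, hEE, sub_zero, sub_add_cancel]
  have hsim : K.charpoly = N.charpoly := by
    calc K.charpoly = (K * ((1 + E) * (1 - E))).charpoly := by rw [h1E, Matrix.mul_one]
      _ = ((K * (1 + E)) * (1 - E)).charpoly := by rw [Matrix.mul_assoc]
      _ = ((1 - E) * (K * (1 + E))).charpoly := Matrix.charpoly_mul_comm _ _
      _ = N.charpoly := by rw [hN]
  -- assemble
  rw [hsim, hcharN, ← Finset.mul_prod_erase univ _ (mem_univ ℓ), hNℓℓ]
  refine congrArg₂ (· * ·) rfl (Finset.prod_congr rfl fun x hx => ?_)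
  rw [hNij x x (Finset.ne_of_mem_erase hx) (Finset.ne_of_mem_erase hx)]

/-- `1` is an eigenvalue-root of `charpoly K` (the stationary direction). -/
theorem imhMatrix_charpoly_eval_one {p q : X → ℝ} (hp : ∀ x, 0 < p x) (hq : ∀ x, 0 < q x)
    {ℓ : X} (hℓ : ∀ x, p ℓ * q x ≤ p x * q ℓ) : (imhMatrix p q).charpoly.eval 1 = 0 := by
  rw [imhMatrix_charpoly hp hq hℓ, Polynomial.eval_mul]
  simp

/-- Every rejection probability `G x x = 1 − a x` of a state other than the lightest is a root of
`charpoly K`. -/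
theorem imhMatrix_charpoly_eval_diag {p q : X → ℝ} (hp : ∀ x, 0 < p x) (hq : ∀ x, 0 < q x)
    {ℓ : X} (hℓ : ∀ x, p ℓ * q x ≤ p x * q ℓ) {x : X} (hx : x ≠ ℓ) :
    (imhMatrix p q).charpoly.eval (liuG p q x x) = 0 := by
  rw [imhMatrix_charpoly hp hq hℓ, Polynomial.eval_mul, Polynomial.eval_prod]
  have h0 : ∏ y ∈ univ.erase ℓ, Polynomial.eval (liuG p q x x)
      (Polynomial.X - Polynomial.C (liuG p q y y)) = 0 :=
    Finset.prod_eq_zero (Finset.mem_erase.mpr ⟨hx, mem_univ x⟩) (by simp)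
  rw [h0, mul_zero]

/-- The spectrum with multiplicity: the roots of `charpoly K` are `1` and the `G x x = 1 − a x`,
`x ≠ ℓ` — `Fintype.card X` real roots, so `charpoly K` splits over `ℝ`. -/
theorem imhMatrix_charpoly_roots {p q : X → ℝ} (hp : ∀ x, 0 < p x) (hq : ∀ x, 0 < q x)
    {ℓ : X} (hℓ : ∀ x, p ℓ * q x ≤ p x * q ℓ) :
    (imhMatrix p q).charpoly.roots = {1} + (univ.erase ℓ).val.map (fun x => liuG p q x x) := by
  have hmon1 : (Polynomial.X - Polynomial.C (1 : ℝ)).Monic := Polynomial.monic_X_sub_C 1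
  have hmon2 : (∏ x ∈ univ.erase ℓ, (Polynomial.X - Polynomial.C (liuG p q x x))).Monic :=
    Polynomial.monic_prod_of_monic _ _ fun x _ => Polynomial.monic_X_sub_C _
  rw [imhMatrix_charpoly hp hq hℓ, Polynomial.roots_mul (hmon1.mul hmon2).ne_zero,
    Polynomial.roots_X_sub_C, Polynomial.roots_prod _ _ hmon2.ne_zero]
  congr 1
  simp only [Polynomial.roots_X_sub_C]
  exact Multiset.bind_singleton _ _

/-- The two forms differ by `X` versus `X − 1`: with the model law normalised (`Σ q = 1`, so that
`G ℓ ℓ = 0`), `charpoly K · X = (X − 1) · charpoly G`. -/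
theorem imhMatrix_charpoly_mul_X {p q : X → ℝ} (hp : ∀ x, 0 < p x) (hq : ∀ x, 0 < q x)
    (hq1 : ∑ x, q x = 1) {ℓ : X} (hℓ : ∀ x, p ℓ * q x ≤ p x * q ℓ) :
    (imhMatrix p q).charpoly * Polynomial.X =
      (Polynomial.X - Polynomial.C 1) * (Matrix.of (liuG p q)).charpoly := by
  rw [imhMatrix_charpoly hp hq hℓ, liuG_charpoly hp hq, ← Finset.mul_prod_erase univ _ (mem_univ ℓ),
    liuG_diag_eq_zero_of_lightest hp hq1 hℓ, Polynomial.C_0, sub_zero]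
  ring

end Summit.Ventures.LatticeQCDFlow.Scoring
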